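import Mathlib.LinearAlgebra.Matrix.Nondegenerate
import Mathlib.LinearAlgebra.Dimension.StrongRankCondition
import Literature.NumberTheory.EllipticCurves.Heights
import Literature.NumberTheory.EllipticCurves.MordellWeil

/-!
# Route HigherGrossZagier — the Gram lemma (BirchSwinnertonDyer)

Target: `Summits/BirchSwinnertonDyer/Theorems/HigherGrossZagier/Gram.lean`.

Crux #5 of route `BirchSwinnertonDyer/HigherGrossZagier` (items stmt-BirchSwinnertonDyer-0503 /
-0149) is the linear-algebra step: if the Néron–Tate Gram determinant `det (⟨Pᵢ, Pⱼ⟩)` of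
`P : Fin n → E(ℚ)` is non-zero then `n ≤ rank_ℤ E(ℚ)`. As FILED the item carries no fact
hypotheses, but both inputs it needs are named facts (def-Props, D-0014), not theorems:
additivity of the pairing `WeierstrassCurve.Affine.Point.heightPairing_add_left` (Silverman AEC
VIII.9.3(c)) and the Mordell–Weil theorem `WeierstrassCurve.module_finite_point` (without which
`mordellWeilRank = Module.finrank ℤ E(ℚ)` is the junk value `0`). This file proves the CORRECTED
statement `gram_lemma`, with exactly these two facts as hypotheses; the planner should re-file crux #5
with this signature (refuter note on stmt-BirchSwinnertonDyer-0503).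

Proof: additivity gives `⟨0, Q⟩ = 0`, `⟨-P, Q⟩ = -⟨P, Q⟩`, `⟨m • P, Q⟩ = m ⟨P, Q⟩` and
`⟨∑ gᵢ • Pᵢ, Q⟩ = ∑ gᵢ ⟨Pᵢ, Q⟩`; so an integer relation `∑ gᵢ • Pᵢ = 0` gives `g ᵥ* G = 0` for the
Gram matrix `G`, hence `g = 0` (`Matrix.eq_zero_of_vecMul_eq_zero`); thus `P` is `ℤ`-linearly
independent and `n ≤ finrank_ℤ E(ℚ)` (`LinearIndependent.fintype_card_le_finrank`, using
Mordell–Weil). Symmetry and torsion-vanishing are not needed. (Silverman AEC VIII.9; Cremona,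
*Algorithms* §3.4.)
-/

noncomputable section

namespace Literature.EllArith

open WeierstrassCurve WeierstrassCurve.Affine.Point

/-- **Gram lemma** (corrected crux #5 of route HigherGrossZagier, cf. stmt-BirchSwinnertonDyer-0503):
for an elliptic curve `E/ℚ`, assuming the Mordell–Weil theorem (`module_finite_point`) and
additivity of the Néron–Tate pairing (`heightPairing_add_left`), a family `P : Fin n → E(ℚ)` with
non-zero Gram determinant `det (⟨Pᵢ, Pⱼ⟩) ≠ 0` has `n ≤ rank_ℤ E(ℚ)`. [folklore] -/
theorem gram_lemma :
    ∀ (W : WeierstrassCurve ℚ) [W.IsElliptic], W.module_finite_point →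
      @WeierstrassCurve.Affine.Point.heightPairing_add_left ℚ _ _ W →
      ∀ (n : ℕ) (P : Fin n → W.toAffine.Point),
        (Matrix.of fun i j => (P i).heightPairing (P j)).det ≠ 0 → n ≤ W.mordellWeilRank := by
  intro W _ hMW hadd0 n P hdet
  -- The named facts (generic `K`, `open scoped Classical`) carry the group law on `E(ℚ)` built from
  -- the classical `DecidableEq ℚ`; here instance search finds `instDecidableEqRat`. The two
  -- instances are equal (`Subsingleton (DecidableEq ℚ)`), and `convert` bridges them.
  haveI : Module.Finite ℤ W.toAffine.Point := by convert hMW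
  have hadd : ∀ P Q R : W.toAffine.Point,
      heightPairing (P + Q) R = heightPairing P R + heightPairing Q R := by
    intro P Q R
    convert hadd0 P Q R
  have hzero : ∀ Q : W.toAffine.Point, heightPairing 0 Q = 0 := by
    intro Q
    have h := hadd 0 0 Q
    rw [zero_add] at h
    linarith
  have hneg : ∀ R Q : W.toAffine.Point, heightPairing (-R) Q = -heightPairing R Q := by
    intro R Q
    have h := hadd (-R) R Q
    rw [neg_add_cancel, hzero] at h
    linarith
  have hnsmul : ∀ (m : ℕ) (R Q : W.toAffine.Point),
      heightPairing (m • R) Q = (m : ℝ) * heightPairing R Q := by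
    intro m R Q
    induction m with
    | zero => simp [hzero]
    | succ m ih =>
      rw [succ_nsmul, hadd, ih]
      push_cast
      ring
  have hzsmul : ∀ (m : ℤ) (R Q : W.toAffine.Point),
      heightPairing (m • R) Q = (m : ℝ) * heightPairing R Q := by
    intro m R Q
    obtain ⟨k, rfl | rfl⟩ := m.eq_nat_or_neg
    · rw [natCast_zsmul, hnsmul]
      norm_cast
    · rw [neg_zsmul, natCast_zsmul, hneg, hnsmul]
      push_cast
      ring
  have hsum : ∀ (g : Fin n → ℤ) (Q : W.toAffine.Point),
      heightPairing (∑ i, g i • P i) Q = ∑ i, (g i : ℝ) * heightPairing (P i) Q := by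
    intro g Q
    have key : ∀ s : Finset (Fin n),
        heightPairing (∑ i ∈ s, g i • P i) Q = ∑ i ∈ s, (g i : ℝ) * heightPairing (P i) Q := by
      intro s
      induction s using Finset.induction_on with
      | empty => simp [hzero]
      | insert a s ha ih => rw [Finset.sum_insert ha, Finset.sum_insert ha, hadd, hzsmul, ih]
    exact key Finset.univ
  have hli : LinearIndependent ℤ P := by
    rw [Fintype.linearIndependent_iff]
    intro g hg i
    have hvec : Matrix.vecMul (fun i => (g i : ℝ))
        (Matrix.of fun i j => (P i).heightPairing (P j)) = 0 := by
      ext j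
      simp only [Matrix.vecMul, dotProduct, Matrix.of_apply, Pi.zero_apply]
      rw [← hsum g (P j), hg, hzero]
    have h0 := Matrix.eq_zero_of_vecMul_eq_zero hdet hvec
    have hi := congr_fun h0 i
    simp only [Pi.zero_apply, Int.cast_eq_zero] at hi
    exact hi
  have h := hli.fintype_card_le_finrank
  rw [Fintype.card_fin] at h
  unfold WeierstrassCurve.mordellWeilRank
  convert h

end Literature.EllArith

end
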